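import Mathlib
import HarnessLib
import Literature.Combinatorics.Additive.OneHoleProgressionTransfer
import Literature.Combinatorics.Additive.StepBeyondKempermanCore

/-!
# Grynkiewicz 2009, §6 display (51): `d⊆(\overline{A + B}, 𝒬𝒜𝒫_d) ≥ 2`

[cite: Grynkiewicz2009, §6 displays (50)–(51) (proof of Thm 4.1)] [tag: critical-pair] [tag: inverse-theorem]

Topic `Literature/Combinatorics/Additive`.  Cell `mm-stpp` (D-0046), seat `mm-stpp-lit` (gen 23); the
port of D. J. Grynkiewicz, *A step beyond Kemperman's structure theorem*, Mathematika **55** (2009)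
67–114 continued.  §6, CASE I (print p. 28; the overlines lost in the print's text layer are restored
from arXiv:0710.1041v2): «If `d⊆(A, 𝒬𝒜𝒫_d) ≤ 1`, then `d⊆(A, 𝒬𝒫) ≥ 2` (eq. (47)) implies that
`d⊆(A, 𝒜𝒫) ≤ 1`.  Likewise for `B`.  Thus in view of Lemmas 5.8 and 5.10 … it follows that (50)
`d⊆(A, 𝒬𝒜𝒫_d), d⊆(B, 𝒬𝒜𝒫_d) ≥ 2` for all nonzero `d ∈ G`, else the proof is complete.  Likewise, if
`d⊆(\overline{A + B}, 𝒬𝒜𝒫_d) ≤ 1`, then `d⊆(\overline{A + B}, 𝒬𝒫) ≥ 2` (eq. (49)) implies that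
`d⊆(\overline{A + B}, 𝒜𝒫) ≤ 1`, whence in view of Lemmas 5.8 and 5.10 — which we can apply to
`(−B, −γ + \overline{A + B})`, where `γ ∈ \overline{A + B}`, in view of Proposition 2.4, Claims 3 and 5,
(45), (46), (48) and the previous paragraph — it follows that either `d⊆(B, 𝒬𝒜𝒫_{d′}) ≤ 1` for some
nonzero `d′ ∈ G`, or else `d⊆(B, 𝒬𝒫) ≤ 1`, both contradictions (to (50) or (47)).  Therefore we can
assume `d⊆(\overline{A + B}, 𝒬𝒜𝒫_d) ≥ 2` for all nonzero `d ∈ G` as well.  Consequently, (51)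
`d⊆(C, 𝒜𝒫) ≥ 2` for `C ∈ {A, B, \overline{A + B}}`.»

The (50) step for `A` is `seventeen_of_subsetDist_quasiProgression_le_one`
(`OneHoleProgressionTransfer.lean`); this file adds the step for `B` (by symmetry) and the step for
`\overline{A + B}`: Lemmas 5.8 / 5.10 are applied to the translated dual pair
`(X, Y) = (−γ + \overline{A + B}, −B)` of Proposition 2.4 (`isNonExtendible_pair_neg_compl'`:
`X + Y = −γ + Ā`), whose hypotheses are (48) for `Ā`, Lemma 5.4 (`not_isQuasiPeriodic_add_and_compl`:
`X` not quasi-periodic, `⟨X⟩ = G`) and «at most one of `|A|`, `|\overline{A + B}|` is three»; their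
conclusions about `Y = −B` are carried back to `B` by the negation invariance of `𝒬𝒜𝒫_d` and `𝒬𝒫`
(`subsetDist_neg_eq`), contradicting (50) for `B` or (47) for `B`.

MAIN RESULTS (0 definitions, 0 named facts; everything PROVED).
* `subsetDist_vadd_eq`, `subsetDist_neg_eq` — `d⊆(·, 𝒮)` is invariant under translation / negation
  for translation- / negation-invariant families `𝒮` (here `𝒬𝒫`, `𝒬𝒜𝒫_d`, `𝒜𝒫_d`).
* `Grynkiewicz2009.seventeen_of_subsetDist_quasiProgression_le_one_right` — the (50) step for `B`.
* `Grynkiewicz2009.two_le_subsetDist_compl_quasiProgression` — **display (51) for `\overline{A + B}`**: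
  under the core-case standing assumptions with (47), (48) (for `Ā`), (49), (50) (for `B`) and
  «`|\overline{A + B}| = 3 → |A| ≠ 3`», `d⊆(\overline{A + B}, 𝒬𝒜𝒫_d) ≥ 2` for every nonzero `d`.

## References
* D. J. Grynkiewicz, *A step beyond Kemperman's structure theorem*, Mathematika 55 (2009) 67–114,
  doi:10.1112/S0025579300000966, §6 (p. 28, displays (50)–(51)), Prop 2.4, Lemmas 5.4, 5.8, 5.10
  [cite: Grynkiewicz2009, Thm 4.1 (proof, displays (50)–(51))] — held
  `paper:doi-10-1112-s0025579300000966` p0028 and `paper:arxiv-0710.1041` p0024, read 2026-08-29.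
-/

namespace Literature.Combinatorics.Additive

open Finset
open scoped Pointwise

universe u

variable {G : Type u} [AddCommGroup G] [DecidableEq G]

/-! ### Invariance of `d⊆(·, 𝒮)` under translation and negation -/

/-- `d⊆(a + A, 𝒮) = d⊆(A, 𝒮)` for a translation-invariant family `𝒮`. [cite: Grynkiewicz2009, §2] -/
theorem subsetDist_vadd_eq {A : Finset G} {𝒮 : Set (Finset G)} (a : G)
    (h𝒮 : ∀ P : Finset G, a +ᵥ P ∈ 𝒮 ↔ P ∈ 𝒮) : subsetDist (a +ᵥ A) 𝒮 = subsetDist A 𝒮 := by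
  refine le_antisymm (le_subsetDist_iff.2 fun P hP hAP => ?_) (le_subsetDist_iff.2 fun P hP hAP => ?_)
  · have h := subsetDist_le ((h𝒮 P).2 hP) (vadd_finset_subset_vadd_finset (a := a) hAP)
    rwa [← vadd_finset_sdiff, card_vadd_finset] at h
  · have hP' : (-a) +ᵥ P ∈ 𝒮 := by rw [← h𝒮, vadd_neg_vadd]; exact hP
    have hAP' : A ⊆ (-a) +ᵥ P := by
      have := vadd_finset_subset_vadd_finset (a := -a) hAP
      rwa [neg_vadd_vadd] at this
    have h := subsetDist_le hP' hAP'
    have e : ((-a) +ᵥ P) \ A = (-a) +ᵥ (P \ (a +ᵥ A)) := by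
      rw [vadd_finset_sdiff, neg_vadd_vadd]
    rwa [e, card_vadd_finset] at h

/-- `−(s ∖ t) = (−s) ∖ (−t)`. [folklore] -/
private theorem neg_sdiff_eq (s t : Finset G) : -(s \ t) = (-s) \ (-t) := by
  ext x
  simp only [mem_neg', mem_sdiff]

/-- `d⊆(−A, 𝒮) = d⊆(A, 𝒮)` for a negation-invariant family `𝒮`. [cite: Grynkiewicz2009, §2] -/
theorem subsetDist_neg_eq {A : Finset G} {𝒮 : Set (Finset G)}
    (h𝒮 : ∀ P : Finset G, -P ∈ 𝒮 ↔ P ∈ 𝒮) : subsetDist (-A) 𝒮 = subsetDist A 𝒮 := by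
  refine le_antisymm (le_subsetDist_iff.2 fun P hP hAP => ?_) (le_subsetDist_iff.2 fun P hP hAP => ?_)
  · have h := subsetDist_le ((h𝒮 P).2 hP) (neg_subset_neg hAP)
    rwa [← neg_sdiff_eq, card_neg] at h
  · have hP' : -P ∈ 𝒮 := (h𝒮 P).2 ?_
    · have hAP' : A ⊆ -P := by have := neg_subset_neg hAP; rwa [neg_neg] at this
      have h := subsetDist_le hP' hAP'
      have e : (-P) \ A = -(P \ (-A)) := by rw [neg_sdiff_eq, neg_neg]
      rwa [e, card_neg] at h
    · exact hP

/-- `𝒜𝒫_d` is negation invariant. [cite: Grynkiewicz2009, §2] -/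
theorem isAP_neg_iff' {s : Finset G} {d : G} : IsAP (-s) d ↔ IsAP s d :=
  ⟨fun h => by have := h.neg; rwa [neg_neg] at this, fun h => h.neg⟩

namespace Grynkiewicz2009

/-! ### The (50) step for `B` -/

/-- **Display (50) for `B`** (by symmetry from `seventeen_of_subsetDist_quasiProgression_le_one`):
under the core-case standing assumptions for `(A, B)` with `⟨B⟩ = G`, `d⊆(B, 𝒬𝒫) ≥ 2` and
«`|B| = 3 → |\overline{A + B}| ≠ 3`», if `d⊆(B, 𝒬𝒜𝒫_d) ≤ 1` for some nonzero `d` then (17) holds.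
[cite: Grynkiewicz2009, §6 display (50) («Likewise for B»)] -/
theorem seventeen_of_subsetDist_quasiProgression_le_one_right [Fintype G] {A B : Finset G} {d : G}
    (hA3 : 3 ≤ #A) (hB3 : 3 ≤ #B) (h0A : (0 : G) ∈ A) (h0B : (0 : G) ∈ B)
    (hAB : #(A + B) = #A + #B)
    (hP3 : ∀ P : Finset G, A + B ⊆ P → P.addStab ≠ {0} → 3 ≤ #(P \ (A + B)))
    (hneA : IsNonExtendible A B) (hneB : IsNonExtendible B A)
    (hgenB : AddSubgroup.closure (B : Set G) = ⊤)
    (hQP : 2 ≤ subsetDist B {P | IsQuasiPeriodic P}) (hd : d ≠ 0)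
    (hq : subsetDist B {P | IsQuasiProgression d P} ≤ 1) (h33 : #B = 3 → #(A + B)ᶜ ≠ 3) :
    ∃ α β : G, #(insert α A + insert β B) + 1 = #(insert α A) + #(insert β B) := by
  have hBA : #(B + A) = #B + #A := by rw [add_comm, hAB, add_comm]
  have hP3' : ∀ P : Finset G, B + A ⊆ P → P.addStab ≠ {0} → 3 ≤ #(P \ (B + A)) := by
    rw [add_comm]; exact hP3
  have h33' : #B = 3 → #(B + A)ᶜ ≠ 3 := by rw [add_comm]; exact h33
  exact seventeen_symm (seventeen_of_subsetDist_quasiProgression_le_one hB3 hA3 h0B h0A hBA hP3' hneB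
    hneA hgenB hQP hd hq h33')

/-! ### Display (51) for `\overline{A + B}` -/

/-- **Display (51) for `\overline{A + B}`.**  Under the core-case standing assumptions (`G` finite,
`0 ∈ A ∩ B`, `|A|, |B|, |\overline{A + B}| ≥ 3`, `|A + B| = |A| + |B|`, `A + B` aperiodic, `(A, B)`
non-extendible, `⟨A⟩ = G`, `A` not quasi-periodic) together with (48) for `Ā`
(`d⊆(Ā, 𝒫) ≥ 3`), (47) and (50) for `B` (`d⊆(B, 𝒬𝒫) ≥ 2`, `d⊆(B, 𝒬𝒜𝒫_{d′}) ≥ 2` for all nonzero `d′`),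
(49) (`d⊆(\overline{A + B}, 𝒬𝒫) ≥ 2`) and «`|\overline{A + B}| = 3 → |A| ≠ 3`»:
`d⊆(\overline{A + B}, 𝒬𝒜𝒫_d) ≥ 2` for every nonzero `d`.  Proof as printed (module docstring):
otherwise `d⊆(\overline{A + B}, 𝒜𝒫_d) ≤ 1` (`subsetDist_isAP_le_one_of_quasiProgression`), and Lemma 5.8
(value `0`) or Lemma 5.10 (value `1`) for the pair `(−γ + \overline{A + B}, −B)` yields
`d⊆(B, 𝒬𝒜𝒫_{d′}) ≤ 1` for some nonzero `d′` or `d⊆(B, 𝒬𝒫) = 1`.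
[cite: Grynkiewicz2009, §6 display (51) (proof of Thm 4.1, p. 28)] -/
theorem two_le_subsetDist_compl_quasiProgression [Fintype G] {A B : Finset G}
    (h0A : (0 : G) ∈ A) (h0B : (0 : G) ∈ B) (hA3 : 3 ≤ #A) (hB3 : 3 ≤ #B) (hC3 : 3 ≤ #(A + B)ᶜ)
    (hAB : #(A + B) = #A + #B) (haper : (A + B).addStab = {0})
    (h48 : ∀ P : Finset G, Aᶜ ⊆ P → P.addStab ≠ {0} → 3 ≤ #(P \ Aᶜ))
    (hneA : IsNonExtendible A B) (hneB : IsNonExtendible B A)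
    (hgen : AddSubgroup.closure (A : Set G) = ⊤) (hAqp : ¬ IsQuasiPeriodic A)
    (h47 : 2 ≤ subsetDist B {P | IsQuasiPeriodic P})
    (h50 : ∀ d' : G, d' ≠ 0 → 2 ≤ subsetDist B {P | IsQuasiProgression d' P})
    (h49 : 2 ≤ subsetDist (A + B)ᶜ {P | IsQuasiPeriodic P})
    (h33 : #(A + B)ᶜ = 3 → #A ≠ 3) {d : G} (hd : d ≠ 0) :
    2 ≤ subsetDist (A + B)ᶜ {P | IsQuasiProgression d P} := by
  classical
  by_contra hlt
  have hq : subsetDist (A + B)ᶜ {P | IsQuasiProgression d P} ≤ 1 := by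
    by_contra h1
    exact hlt (by
      have := Order.add_one_le_of_lt (not_le.1 h1)
      rwa [one_add_one_eq_two] at this)
  have hAPle := subsetDist_isAP_le_one_of_quasiProgression hq h49
  -- the translated dual pair `(X, Y) = (−γ + (A + B)ᶜ, −B)`
  have hAne : A.Nonempty := ⟨0, h0A⟩
  have hBne : B.Nonempty := ⟨0, h0B⟩
  obtain ⟨γ, hγ⟩ : ((A + B)ᶜ).Nonempty := card_pos.1 (by omega)
  obtain ⟨hsum, hneX₀, hneY₀⟩ := isNonExtendible_pair_neg_compl' hneA hneB
  obtain ⟨-, hCqp, hCgen⟩ :=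
    not_isQuasiPeriodic_add_and_compl hA3 hC3 h0A h0B hAB haper hneA hneB hgen hAqp
  set X : Finset G := (-γ) +ᵥ (A + B)ᶜ with hX
  set Y : Finset G := -B with hY
  have hXY_eq : X + Y = (-γ) +ᵥ Aᶜ := by
    rw [hX, hY, vadd_add_assoc, add_comm ((A + B)ᶜ) (-B), hsum]
  have hXcard : #X = #(A + B)ᶜ := card_vadd_finset _ _
  have hYcard : #Y = #B := card_neg B
  have hGcard : Fintype.card G = #A + #B + #(A + B)ᶜ := by
    have h1 := card_compl (A + B)
    have h2 := card_le_univ (A + B)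
    omega
  have hAc : #Aᶜ = #B + #(A + B)ᶜ := by
    rw [card_compl, hGcard]; omega
  have hXY : #(X + Y) = #X + #Y := by rw [hXY_eq, card_vadd_finset, hAc, hXcard, hYcard, add_comm]
  have h0X : (0 : G) ∈ X := mem_vadd_finset.2 ⟨γ, hγ, by simp⟩
  have h0Y : (0 : G) ∈ Y := by rw [hY, mem_neg', neg_zero]; exact h0B
  have hX3 : 3 ≤ #X := by rw [hXcard]; exact hC3
  have hY3 : 3 ≤ #Y := by rw [hYcard]; exact hB3
  have hP3X : ∀ P : Finset G, X + Y ⊆ P → P.addStab ≠ {0} → 3 ≤ #(P \ (X + Y)) := by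
    rw [hXY_eq]; exact forall_card_sdiff_vadd _ h48
  have hneX : IsNonExtendible X Y := hneY₀.vadd_left (-γ)
  have hneY : IsNonExtendible Y X := hneX₀.vadd_right (-γ)
  have hgenX : AddSubgroup.closure (X : Set G) = ⊤ := hCgen γ hγ
  have hXqp : ¬ IsQuasiPeriodic X := fun h => hCqp ((isQuasiPeriodic_vadd_iff _).1 h)
  have hAcne : Aᶜ.Nonempty := card_pos.1 (by omega)
  have hAaper : A.addStab = {0} := by
    by_contra h
    exact hAqp (((isPeriodic_iff_addStab_ne hAne).2 h).isQuasiPeriodic hAne)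
  have haperXY : (X + Y).addStab = {0} := by
    rw [hXY_eq, addStab_vadd, addStab_compl hAne hAcne, hAaper]
  -- `d⊆(X, 𝒜𝒫_d) = d⊆((A + B)ᶜ, 𝒜𝒫_d) ≤ 1`
  have hXAP : subsetDist X {P | IsAP P d} = subsetDist (A + B)ᶜ {P | IsAP P d} :=
    subsetDist_vadd_eq (-γ) fun P => isAP_vadd_iff (-γ)
  -- negation invariance for `B`
  have hYQAP : ∀ d' : G, subsetDist Y {P | IsQuasiProgression d' P} =
      subsetDist B {P | IsQuasiProgression d' P} :=
    fun d' => subsetDist_neg_eq fun P => isQuasiProgression_neg_iff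
  have hYQP : subsetDist Y {P | IsQuasiPeriodic P} = subsetDist B {P | IsQuasiPeriodic P} :=
    subsetDist_neg_eq fun P => isQuasiPeriodic_neg_iff
  rcases eq_or_lt_of_le hAPle with h1 | h0
  · -- `d⊆ = 1`: Lemma 5.10 for `(X, Y)`
    have hdX : subsetDist X {P | IsAP P d} = 1 := by rw [hXAP]; exact h1
    have h33X : #X = 3 → #(X + Y)ᶜ ≠ 3 := by
      intro h3
      have : #(X + Y)ᶜ = #A := by rw [card_compl, hXY, hGcard, hXcard, hYcard]; omega
      rw [this]
      exact h33 (by rw [← hXcard]; exact h3)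
    obtain ⟨-, halt⟩ := seventeen_of_subsetDist_isAP_eq_one hX3 hY3 h0X h0Y hXY hP3X hneX hneY hgenX
      hXqp hd hdX h33X
    rcases halt with hle | ⟨d', hd', h0'⟩ | hsix
    · rw [hYQAP] at hle
      exact absurd (h50 d hd) (not_le.2 (lt_of_le_of_lt hle (by decide)))
    · rw [hYQAP] at h0'
      have := h50 d' hd'
      rw [h0'] at this
      exact absurd this (by decide)
    · have hYmem : Y ∈ ({X, Y, X + Y, Xᶜ, Yᶜ, (X + Y)ᶜ} : Finset (Finset G)) := by simp
      have := hsix Y hYmem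
      rw [hYQP] at this
      rw [this] at h47
      exact absurd h47 (by decide)
  · -- `d⊆ = 0`: `(A + B)ᶜ`, hence `X`, is a progression; Lemma 5.8 for `(X, Y)`
    have h0' : subsetDist X {P | IsAP P d} = 0 := by rw [hXAP]; exact Order.lt_one_iff.1 h0
    have hXd : IsAP X d := subsetDist_eq_zero_iff.1 h0'
    have h58 := (subsetDist_quasiProgression_of_isAP hXY hX3 haperXY hXd).1
    rw [hYQAP] at h58
    have := h50 d hd
    rw [h58] at this
    exact absurd this (by decide)

end Grynkiewicz2009

end Literature.Combinatorics.Additive
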